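import Summits.Langlands.Langlands.Theses.PhantomRMYoshida
import Literature.NumberTheory.Automorphic.GLnAdelicStructureProofs
import Literature.NumberTheory.GaloisRepresentations.PadicComplexEmbedding

/-!
# Disproof workfile for crux `SerreKWAutomorphicGL2` (item stmt-Langlands-12944, route PhantomRMYoshida)

Standing adversary's findings (refuter-cdisprove-stmt-Langlands-12944-0, cycle 1).

**Verdict so far: NO KILL — the crux is a faithful typing of a theorem in print** (Serre's
modularity conjecture for `GL₂/ℚ`: Khare–Wintenberger I, Invent. Math. 178 (2009),
doi:10.1007/s00222-009-0205-7, p.2 definition of S-type = continuous, absolutely irreducible, odd,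
`F` finite of characteristic `p`; p.3 Thm 1.2; p.17 Thm 9.1 "Assume Hypothesis (H). Then Serre's
conjecture is true", (H) = Kisin's 2-adic lifting theorem — pages read this session; plus the
Deligne/Carayol newform → `ℓ`-adic dictionary and the classical → adelic dictionary in Buzzard–Gee's
L-normalisation).  What this file records, as Lean:

* §1 `ResAutGL2` — the conclusion of the crux isolated as a predicate of `(p, red, σ)`;
  `serreKW_iff` shows the crux is literally `∀ p k red σ, IsOdd → IsIrreducible → ResAutGL2`.
* §2 LOAD-BEARING ANALYSIS.  `WithoutIsOdd`, `WithoutIsIrreducible` (the crux with one hypothesis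
  dropped) and the trivial implications back to the crux.  Neither weakening is refutable here:
  - `IsOdd`: at `p = 2` it is AUTOMATIC (`isOdd_of_charP_two`: `det σ(c)² = 1` forces
    `det σ(c) = 1 = -1` in characteristic 2), so the `p = 2` slice of the crux is ALREADY the
    even-looking statement "every irreducible `σ̄ : Γ_ℚ → GL₂(k)`, `char k = 2`, is residually
    cuspidal-automorphic" (`serreKW_two_without_odd`) — covered in print (KW I Thm 9.1 + Kisin 2009;
    oddness is vacuous at 2 in the definition of S-type).  For odd `p`, dropping `IsOdd` gives the
    "even residual automorphy" statement: TRUE for even `σ̄` with dihedral / tetrahedral / octahedral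
    projective image (Teichmüller lift to an even Artin representation, automorphic induction /
    Langlands–Tunnell give an L-algebraic Maass cusp form with `λ = 1/4` whose Satake parameters are
    the Frobenius eigenvalues — roots of unity, `p`-integral, reducing to `σ̄`), conjecturally FALSE
    for even `σ̄` with projective image `PSL₂(𝔽_q)`, `q ≥ 7` (no L-algebraic cuspidal `π₂` on `GL₂/ℚ`
    should be congruent to it: holomorphic ones are odd, algebraic Maass ones should have finite
    image), but that needs Galois representations for algebraic Maass forms — OPEN.  So `IsOdd` is
    load-bearing for the printed proof and only conjecturally for truth.
  - `IsIrreducible`: the conclusion `ResAutGL2 red σ` only sees `σ` through its a.e. Frobenius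
    characteristic polynomials (`ResAutGL2.of_frobData`), i.e. through `σ^ss`; for ODD reducible
    semisimple `σ̄ = ν ⊕ ν'` the conclusion is a THEOREM in print for every `p`: Billerey–Menares,
    Math. Res. Lett. 23 (2016) = arXiv:1309.3717, Thm 1 (p.3, read): "Every odd representation which
    is the direct sum of two characters arises from a cuspidal eigenform" (Eisenstein series
    `E_k^{1,ε₀}` minus an oldform, reduced mod `λ` at an auxiliary prime, Deligne–Serre lifting; Thm 2.2
    gives the explicit types).  Hence `IsIrreducible` is NOT load-bearing for truth, only for the KW
    proof; a prover cannot exploit this (same missing dictionary), a planner may drop it if convenient.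
* §3 SANITY OF THE QUANTIFIERS.  `red : 𝒪_{ℚ̄_p} →+* k` is forced to be reduction modulo the
  maximal ideal followed by an embedding of the residue field (`red_eq_zero_of_not_isUnit`: any ring
  map to a reduced ring of characteristic `p` kills the non-units, because `v(x) < 1 ⇒ xⁿ ∈ p𝒪`);
  `σ` has finite image (`finite_range`: compact source, discrete target);
  the `Prop`-hypotheses `hcpt₂`, `ι` are inhabited (`hcpt₂_inhabited`, `iota_inhabited`), so the
  crux is not vacuous on their account; the `σ`-hypotheses (an odd irreducible continuous
  `σ̄ : Γ_ℚ → GL₂(k)`) are satisfiable on paper (`ρ̄_{E,ℓ}` for `E = X₀(11)`, `ℓ ≥ 7`) but no such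
  object is constructible in the tree today — which is also why no `¬`-statement about this crux
  can be landed unconditionally.  Remark (hypothesis mutation, paper): `[IsAlgClosed k]` is not
  load-bearing either — the existence of `red` forces `k ⊇ 𝒪/𝔪 ≅ 𝔽̄_p` (`red_factors_through_residue`;
  the tree's `Resolution.isAlgClosed_residueField_of_isAlgClosed` gives `IsAlgClosed (𝒪/𝔪)`), and over
  a field containing `𝔽̄_p` (a splitting field of every finite group) a `k`-irreducible finite-image
  `σ` is absolutely irreducible; `[DiscreteTopology k]` only serves to make the image finite.
* §4 WHY IT RESISTS.  The only conceivable Lean-level failure is a defect of the automorphic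
  interface (`CuspidalAutomorphicRepData 2 ℚ hcpt₂` + `IsLAlgebraic` + `HasSatakeParamAt` jointly
  unsatisfiable in the required pattern); such a defect would break the summit statement
  `Langlands` itself, is not route-specific, and cannot be tested without constructing cusp forms
  on `GL₂(𝔸_ℚ)`.  Every convention flip (arithmetic/geometric Frobenius, sign of the half-twist,
  nebentypus, choice of `ι` vs the residual embedding) is absorbed by the `∃ π₂` (contragredient,
  `π_f ⊗ |det|^{(w-1)/2}`, `f ↦ f̄`, Galois-conjugate newform), as already noted by the rattack stamp.
  THE ONE NON-ABSORBABLE RISK, checked on paper this cycle: a HALF-INTEGRAL mismatch between the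
  Tamagawa normalisation `q^{i(n-i)/2} e_i(α)` hard-wired in `HasSatakeParamAt` and the `ρ`-shifted
  Harish-Chandra parameter behind `IsLAlgebraic` (`HasHCParameter`, `HarishChandraHomGL.highestWeight`:
  `z` acts on a highest-weight vector of weight `λ` by `γ(z)(λ + ρ)`, Knapp Thm 5.44) could NOT be
  repaired by the `∃ π₂` — only twists `|det|^s` with `s ≡ (w-1)/2 (mod ℤ)` keep `π_f ⊗ |det|^s`
  L-algebraic, so an extra factor `q^{1/2} = Real.sqrt q` would survive into
  `arithFrobPolyOfSatake`, entering `ℚ̄_p` through `ι⁻¹(√q)`; as `ι` ranges over ALL isomorphisms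
  (the crux says `∀ ι`) the signs of `ι⁻¹(√q)` vary independently from prime to prime (Kummer theory
  of `ℚ({√q}_q)`: every sign pattern is realised by some `τ ∈ Aut ℂ`), whereas the residual Frobenius
  data of any two L-algebraic witnesses differ on a Chebotarev set — so no family of witnesses could
  serve all `ι`, and such a slip would make the crux FALSE at every odd `p` (at `p = 2` signs are
  invisible).  The conventions are consistent: with
  `λ + ρ` the trivial representation of `GL₂(ℝ)` and the unitary `π_{f,∞}` for weight `2` both have
  parameter `ρ = (1/2, -1/2)` (C-algebraic, Buzzard–Gee §5, as `hasHCParameter_trivial` records),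
  `π_f ⊗ |det|^{1/2}` has `(1, 0)` (L-algebraic) and unitary Satake parameters `α/ℓ^{1/2}` become
  `α/ℓ`, whose inverses `ℓ/α = β χ(ℓ)⁻¹` are algebraic integers reducing to the eigenvalues of
  `ρ̄_{f̄}(Frob_ℓ)`; a `±ρ` sign slip would shift `GL₂` parameters by `2ρ = (1, -1) ∈ ℤ²`, harmless
  for integrality.  NOTE for provers: `HasHCParameter` quantifies over ALL `γ : HarishChandraHomGL ℝ 2`;
  if that hypothesis structure were uninhabited the predicate degenerates to "has an infinitesimal
  character" (crux easier), if it were inhabited NON-uniquely it would be unsatisfiable (crux false) —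
  so the named facts `nonempty_harishChandraHomGL` / `harishChandraHomGL_unique` (Knapp Thm 5.44,
  Verma modules) are silently load-bearing for the meaning of `IsLAlgebraic`.
* §5 PROVER ROADMAP RISKS (where a proof attempt, not the statement, can still founder).
  (R0) The cleanest witness is the ARITHMETICALLY normalised `π₂ := π_f^{unit} ⊗ |det|^{-(w-1)/2}`
  (`L(s, π₂) = L(s, f)`): Satake parameters at `q ∤ Np` are literally the Hecke roots `{α_q, β_q}` of
  `X² - a_q X + ε(q) q^{w-1}`, infinity type `{(0, 1-w), (1-w, 0)}` (integral ⇒ `IsLAlgebraic`), and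
  `arithFrobPolyOfSatake ι q 1 {α, β} = X² - ι⁻¹(a_q ε(q)⁻¹ q^{1-w}) X + ι⁻¹(ε(q)⁻¹ q^{1-w}) ∈ 𝒪[X]`
  (denominators are `p`-units since `q ≠ p`), whose reduction is `charpoly` of the INVERSE of
  `ρ̄_f(Frob_q)`: so apply the tree's `exists_newform_of_odd_irreducible` (SerreConjecture.lean:147,
  conclusion `IsGaloisRepOfNewform1Int f ι_f S ρ̄`: `charpoly ρ̄(arith Frob_q) = ι_f(X² - a_q X +
  ε(q)q^{w-1})`, NewformGaloisRep.lean:209) to the DUAL `σ^∨ = (σᵀ)⁻¹` (still odd, irreducible), not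
  to `σ`.  (R1) CONJUGATION MISMATCH: that fact hands back SOME `ι_f : 𝓞_f →+* k`, while the crux
  fixes `red ∘ ι⁻¹` on `ι(𝒪) ∩ ℤ̄ ⊇ 𝓞_f`; the two homomorphisms `ℤ̄ → k` differ by some
  `τ ∈ Gal(ℚ̄/ℚ)` (transitivity on primes above `p` + lifting residue automorphisms to decomposition
  groups), so the proof needs `f ↦ f^τ` (Aut(ℂ)-stability of newforms and of their Hecke data, Shimura
  1971 Thm 3.48 / Ribet) or a version of the KW fact with the residual place prescribed — neither is in
  the tree; this, not any sign, is the real gap behind the grounder's `cuspidalAutomorphicRepData_of_newform`.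
  (R2) `red` may be assumed to be `φ ∘ residue` (`red_factors_through_residue`), `σ` to have finite
  image (`finite_range`), and at `p = 2` oddness comes for free (`isOdd_of_charP_two`).
* No `-- Targets`: payload.stuck_stubs = [] at this cycle.
-/

set_option linter.dupNamespace false

namespace Summit.Langlands.Langlands.Cruxes.SerreKWAutomorphicGL2.Disproof

open Summit.Langlands.Langlands.Theses.PhantomRMYoshida
open Literature.NumberTheory.GaloisRepresentations Literature.NumberTheory.Automorphic
open IsDedekindDomain Filter
open scoped NNReal

noncomputable section

/-! ## §1 The conclusion as a predicate -/

/-- `ResAutGL2 red σ`: the conclusion of the crux for a fixed prime `p`, reduction map `red` and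
residual representation `σ` — for every `hcpt₂` and every `ι : ℚ̄_p ≃+* ℂ` there is an L-algebraic
cuspidal `π₂` on `GL₂(𝔸_ℚ)` whose arithmetic-Frobenius Satake polynomials are `p`-integral and
reduce through `red` to `charpoly σ(Frob_v)` at almost all `v` (verbatim the crux's conclusion;
this is the planner's requested `IsResiduallyAutomorphicGL2Via`). -/
def ResAutGL2 {p : ℕ} [Fact p.Prime] {k : Type} [Field k] [TopologicalSpace k]
    (red : Valued.integer (PadicAlgCl p) →+* k) (σ : FramedGaloisRep ℚ k 2) : Prop :=
  ∀ (hcpt₂ : isCompact_glFiniteIntegralLevel 2 ℚ) (ι : PadicAlgCl p ≃+* ℂ),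
    ∃ π₂ : CuspidalAutomorphicRepData 2 ℚ hcpt₂, π₂.1.IsLAlgebraic ∧
      ∀ᶠ v : HeightOneSpectrum (NumberField.RingOfIntegers ℚ) in Filter.cofinite,
        ∃ (a : Multiset ℂ) (P : Polynomial (Valued.integer (PadicAlgCl p))) (Pb : Polynomial k),
          π₂.1.HasSatakeParamAt v a ∧
          P.map (Valued.integer (PadicAlgCl p)).subtype = arithFrobPolyOfSatake ι v.residueCard 1 a ∧
          σ.IsUnramifiedAt v ∧ σ.HasFrobCharpolyAt v Pb ∧ P.map red = Pb

/-- The crux, read back: it is literally `∀ p k red σ, σ odd → σ irreducible → ResAutGL2 red σ`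
(definitional unfolding, `Iff.rfl`). -/
theorem serreKW_iff :
    SerreKWAutomorphicGL2 ↔
      ∀ (p : ℕ) [Fact p.Prime] (k : Type) [Field k] [CharP k p] [IsAlgClosed k]
        [TopologicalSpace k] [DiscreteTopology k] (red : Valued.integer (PadicAlgCl p) →+* k)
        (σ : FramedGaloisRep ℚ k 2), σ.IsOdd → σ.toGaloisRep.IsIrreducible → ResAutGL2 red σ :=
  Iff.rfl

/-- The conclusion depends on `σ` only through its a.e. local data (unramifiedness and Frobenius
characteristic polynomials): if `σ'` has, at almost every `v`, the same unramifiedness and the same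
Frobenius polynomials as `σ`, then `ResAutGL2 red σ → ResAutGL2 red σ'`.  In particular the
conclusion cannot distinguish `σ` from its semisimplification (Brauer–Nesbitt direction not needed). -/
theorem ResAutGL2.of_frobData {p : ℕ} [Fact p.Prime] {k : Type} [Field k] [TopologicalSpace k]
    {red : Valued.integer (PadicAlgCl p) →+* k} {σ σ' : FramedGaloisRep ℚ k 2}
    (hdata : ∀ᶠ v : HeightOneSpectrum (NumberField.RingOfIntegers ℚ) in Filter.cofinite,
      (σ.IsUnramifiedAt v → σ'.IsUnramifiedAt v) ∧
        ∀ P : Polynomial k, σ.HasFrobCharpolyAt v P → σ'.HasFrobCharpolyAt v P)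
    (h : ResAutGL2 red σ) : ResAutGL2 red σ' := by
  intro hcpt₂ ι
  obtain ⟨π₂, hL, hae⟩ := h hcpt₂ ι
  refine ⟨π₂, hL, ?_⟩
  filter_upwards [hae, hdata] with v hv hd
  obtain ⟨a, P, Pb, h1, h2, h3, h4, h5⟩ := hv
  exact ⟨a, P, Pb, h1, h2, hd.1 h3, hd.2 Pb h4, h5⟩

/-- Change of frame does not affect the conclusion (`charpoly` and unramifiedness are conjugation
invariant). -/
theorem ResAutGL2.conj {p : ℕ} [Fact p.Prime] {k : Type} [Field k] [TopologicalSpace k]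
    [IsTopologicalRing k] {red : Valued.integer (PadicAlgCl p) →+* k} {σ : FramedGaloisRep ℚ k 2}
    (g : GL (Fin 2) k) (h : ResAutGL2 red σ) : ResAutGL2 red (FramedRep.conj g σ) := by
  refine h.of_frobData (Filter.Eventually.of_forall fun v => ⟨?_, ?_⟩)
  · exact (FramedGaloisRep.isUnramifiedAt_conj_iff v g σ).mpr
  · intro P hP 𝔓 h𝔓 τ hτ
    rw [← hP 𝔓 h𝔓 τ hτ]
    unfold FramedRep.charpoly
    rw [FramedRep.conj_apply, Units.val_mul, Units.val_mul, Matrix.coe_units_inv,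
      Matrix.charpoly_units_conj]

/-! ## §2 Load-bearing analysis -/

/-- The crux WITHOUT the oddness hypothesis ("even residual automorphy" included). Status: not
refutable in the tree or in print; for `p = 2` it coincides with the crux
(`serreKW_two_without_odd`); for odd `p` conjecturally false for even `σ̄` with projective image
`PSL₂(𝔽_q)`, `q ≥ 7`, true for even `σ̄` with soluble projective image (see module docstring). -/
def WithoutIsOdd : Prop :=
  ∀ (p : ℕ) [Fact p.Prime] (k : Type) [Field k] [CharP k p] [IsAlgClosed k]
    [TopologicalSpace k] [DiscreteTopology k] (red : Valued.integer (PadicAlgCl p) →+* k)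
    (σ : FramedGaloisRep ℚ k 2), σ.toGaloisRep.IsIrreducible → ResAutGL2 red σ

/-- The crux WITHOUT the irreducibility hypothesis. Status: by `ResAutGL2.of_frobData` it is the
statement for `σ^ss`; for odd semisimple reducible `σ̄` a theorem in print for every `p`
(Billerey–Menares 2016 Thm 1, arXiv:1309.3717 p.3), so irreducibility is not load-bearing for truth,
only for KW's proof. -/
def WithoutIsIrreducible : Prop :=
  ∀ (p : ℕ) [Fact p.Prime] (k : Type) [Field k] [CharP k p] [IsAlgClosed k]
    [TopologicalSpace k] [DiscreteTopology k] (red : Valued.integer (PadicAlgCl p) →+* k)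
    (σ : FramedGaloisRep ℚ k 2), σ.IsOdd → ResAutGL2 red σ

/-- Any proof of the weakened statement proves the crux (monotonicity; recorded so that the census
can point at the exact weakened `Prop`s). -/
theorem serreKW_of_withoutIsOdd (h : WithoutIsOdd) : SerreKWAutomorphicGL2 :=
  fun p _ k _ _ _ _ _ red σ _ hirr => h p k red σ hirr

/-- Idem for irreducibility. -/
theorem serreKW_of_withoutIsIrreducible (h : WithoutIsIrreducible) : SerreKWAutomorphicGL2 :=
  fun p _ k _ _ _ _ _ red σ hodd _ => h p k red σ hodd

/-- **Boundary case `p = 2`: oddness is automatic.**  For a complex conjugation `c`, `c² = 1`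
(`IsComplexConjugation.sq_eq_one`), so `det σ(c)` is a square root of `1` in the field `k`, i.e.
`±1`, and `-1 = 1` in characteristic `2`.  Hence at `p = 2` the crux quantifies over ALL irreducible
`σ̄`, including those cut out by totally real fields (e.g. `SL₂(𝔽₄) ≅ A₅`-extensions): this is the
`p = 2` case of Serre's conjecture exactly as Khare–Wintenberger state it (S-type: oddness vacuous at
`2`), proved in KW I Thm 9.1 under Hypothesis (H) = Kisin 2009 (2-adic Barsotti–Tate lifting). -/
theorem isOdd_of_charP_two {k : Type} [Field k] [TopologicalSpace k] [CharP k 2] {n : ℕ}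
    (σ : FramedGaloisRep ℚ k n) : σ.IsOdd := by
  intro φ c hc
  have hsq : ((Matrix.GeneralLinearGroup.det (σ c) : kˣ) : k) *
      ((Matrix.GeneralLinearGroup.det (σ c) : kˣ) : k) = 1 := by
    rw [← Units.val_mul, ← map_mul, ← map_mul, ← sq, hc.sq_eq_one, map_one, map_one, Units.val_one]
  rcases mul_self_eq_one_iff.mp hsq with h | h
  · exact Units.ext (by rw [h, Units.val_neg, Units.val_one, CharTwo.neg_eq])
  · exact Units.ext (by rw [h, Units.val_neg, Units.val_one])

/-- Consequence: at `p = 2` the crux already contains its own "even" weakening — every irreducible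
`σ̄ : Γ_ℚ → GL₂(k)`, `char k = 2`, is asserted residually automorphic. (Not a refutation: this slice
is covered in print, see `isOdd_of_charP_two`.) -/
theorem serreKW_two_without_odd (h : SerreKWAutomorphicGL2) (k : Type) [Field k] [CharP k 2]
    [IsAlgClosed k] [TopologicalSpace k] [DiscreteTopology k]
    (red : Valued.integer (PadicAlgCl 2) →+* k) (σ : FramedGaloisRep ℚ k 2)
    (hirr : σ.toGaloisRep.IsIrreducible) : ResAutGL2 red σ :=
  haveI : Fact (Nat.Prime 2) := ⟨Nat.prime_two⟩
  h 2 k red σ (isOdd_of_charP_two σ) hirr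

/-! ## §3 Sanity of the quantifiers -/

/-- **`red` is forced to be reduction mod `𝔪`.**  Any ring homomorphism from the valuation ring
`𝒪 = 𝒪_{ℚ̄_p}` to a reduced ring of characteristic `p` kills every non-unit: if `v(x) < 1` then
`v(x)ⁿ < v(p) = p⁻¹` for some `n` (archimedean property of `ℝ≥0`), so `xⁿ = p · y` with `y ∈ 𝒪`,
whence `red(x)ⁿ = red(p) red(y) = 0` and `red x = 0`.  So the crux's arbitrary `red` is
`(embedding of the residue field 𝔽̄_p into k) ∘ (reduction)`: no exotic reduction maps exist, the
quantifier is exactly as intended. -/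
theorem red_eq_zero_of_not_isUnit {p : ℕ} [Fact p.Prime] {k : Type*} [CommRing k] [IsReduced k]
    [CharP k p] (red : Valued.integer (PadicAlgCl p) →+* k)
    {x : Valued.integer (PadicAlgCl p)} (hx : ¬ IsUnit x) : red x = 0 := by
  have hv : Valued.v (x : PadicAlgCl p) < 1 :=
    Valuation.Integer.not_isUnit_iff_valuation_lt_one.mp hx
  have hp0 : (0 : ℝ≥0) < Valued.v ((p : ℕ) : PadicAlgCl p) := by
    rw [PadicAlgCl.valuation_p]
    have : (0 : ℝ≥0) < (p : ℝ≥0) := by exact_mod_cast (Fact.out : p.Prime).pos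
    positivity
  obtain ⟨n, hn⟩ := exists_pow_lt_of_lt_one hp0 hv
  have hPne : ((p : ℕ) : PadicAlgCl p) ≠ 0 := by exact_mod_cast (Fact.out : p.Prime).ne_zero
  -- `p` and `y = xⁿ / p` as elements of `𝒪`
  have hpint : ((p : ℕ) : PadicAlgCl p) ∈ Valued.integer (PadicAlgCl p) := by
    refine (Valuation.mem_integer_iff _ _).2 ?_
    rw [PadicAlgCl.valuation_p, one_div]
    exact inv_le_one_of_one_le₀ (by exact_mod_cast (Fact.out : p.Prime).one_le)
  have hyint : (x : PadicAlgCl p) ^ n / ((p : ℕ) : PadicAlgCl p) ∈ Valued.integer (PadicAlgCl p) := by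
    refine (Valuation.mem_integer_iff _ _).2 ?_
    rw [map_div₀, map_pow]
    exact (div_le_one₀ hp0).mpr hn.le
  have hxn : x ^ n = ⟨_, hpint⟩ * ⟨_, hyint⟩ := by
    apply Subtype.ext
    change ((x : PadicAlgCl p)) ^ n = ((p : ℕ) : PadicAlgCl p) * ((x : PadicAlgCl p) ^ n / ((p : ℕ) : PadicAlgCl p))
    rw [mul_div_cancel₀ _ hPne]
  have hredp : red ⟨_, hpint⟩ = 0 := by
    have : (⟨_, hpint⟩ : Valued.integer (PadicAlgCl p)) = ((p : ℕ) : Valued.integer (PadicAlgCl p)) :=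
      Subtype.ext (by simp)
    rw [this, map_natCast, CharP.cast_eq_zero]
  have hnil : red x ^ n = 0 := by rw [← map_pow, hxn, map_mul, hredp, zero_mul]
  exact IsReduced.eq_zero _ ⟨n, hnil⟩

/-- **`σ` has finite image** (`Γ_ℚ` is compact, `GL_n(k)` is discrete for discrete `k`): the
crux only ever speaks about residual representations factoring through a finite Galois group
`Gal(L/ℚ)`, i.e. (after conjugation into `GL₂` of a finite subfield, Brauer) exactly KW's S-type
objects; the size of the algebraically closed `k` adds nothing.  `[DiscreteTopology k]` is the
hypothesis doing this work. -/
theorem finite_range {k : Type} [Field k] [TopologicalSpace k] [DiscreteTopology k] {n : ℕ}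
    (σ : FramedGaloisRep ℚ k n) : (Set.range σ).Finite :=
  (isCompact_range (map_continuous σ)).finite_of_discrete

/-- `red` is a local homomorphism: it detects units (immediate from
`red_eq_zero_of_not_isUnit`, since `0` is not a unit of the field `k`). -/
theorem isLocalHom_red {p : ℕ} [Fact p.Prime] {k : Type*} [Field k] [CharP k p]
    (red : Valued.integer (PadicAlgCl p) →+* k) : IsLocalHom red := by
  refine ⟨fun a ha => by_contra fun hna => ?_⟩
  rw [red_eq_zero_of_not_isUnit red hna] at ha
  exact not_isUnit_zero ha

/-- **`red` factors through the residue field `𝔽̄_p = 𝒪/𝔪`**: `red = φ ∘ residue` for a (necessarily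
injective) field embedding `φ : 𝒪/𝔪 →+* k`.  This is the form a prover needs to compare the crux's
`red`-reduction of Satake polynomials with the tree's `ModPGaloisRep`/newform reduction statements
(`khare_wintenberger`, `exists_newform_of_odd_irreducible`), which are phrased with the residue map. -/
theorem red_factors_through_residue {p : ℕ} [Fact p.Prime] {k : Type*} [Field k] [CharP k p]
    (red : Valued.integer (PadicAlgCl p) →+* k) :
    ∃ φ : IsLocalRing.ResidueField (Valued.integer (PadicAlgCl p)) →+* k,
      red = φ.comp (IsLocalRing.residue (Valued.integer (PadicAlgCl p))) := by
  haveI := isLocalHom_red red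
  exact ⟨IsLocalRing.ResidueField.lift red, (IsLocalRing.ResidueField.lift_comp_residue red).symm⟩

/-- Non-vacuity of the `Prop` hypothesis `hcpt₂` (the compactness of `GL₂(ℤ̂)` is proved in the tree). -/
theorem hcpt₂_inhabited : isCompact_glFiniteIntegralLevel 2 ℚ :=
  isCompact_glFiniteIntegralLevel_holds 2 ℚ

/-- Non-vacuity of the `ι` quantifier: a ring isomorphism `ℚ̄_p ≃+* ℂ` exists (cardinality +
Steinitz, proved in the tree). -/
theorem iota_inhabited (p : ℕ) [Fact p.Prime] : Nonempty (PadicAlgCl p ≃+* ℂ) :=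
  NumberField.nonempty_algebraicClosure_padic_ringEquiv_complex p

end

end Summit.Langlands.Langlands.Cruxes.SerreKWAutomorphicGL2.Disproof
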